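import Literature.Geometry.Riemannian.KernelNashEntropySuperharmonic
import Literature.Geometry.Riemannian.KernelNashEntropyPole
import Literature.Geometry.Riemannian.KernelNashEntropyW1Bound
import Literature.Geometry.Riemannian.SharpSmallBallVolume
import Literature.Geometry.Riemannian.RadialIntegralComparison
import Literature.MeasureTheory.Jensen.GibbsInequality
import Mathlib.Analysis.SpecialFunctions.Gaussian.FourierTransform
import HarnessLib

/-!
# A universal upper bound of the pointed Nash entropy of the conjugate heat kernel

R. Bamler, *Entropy and heat kernel bounds on a Ricci flow background*, arXiv:2008.07093 (2020a),
Prop. 5.2 states `𝒩_{x,t}(τ) ≤ 0` for the pointed Nash entropy of the conjugate heat kernel of a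
Ricci flow on a closed manifold; its proof uses the small-time asymptotics of the kernel
(`lim_{τ→0} 𝒩 = 0`), which are not in the tree. This file proves, without asymptotics, the weaker
UNIVERSAL bound

  `𝒩*_s(x, t) ≤ (m/2) log (H_m / (2m))`,  `H_m = (m − 1)π²/2 + 4`,

(`kernelNashEntropy_le_universal`), which serves the same purpose wherever only a dimensional
upper bound of `e^{𝒩}` is needed (Thm. 6.1, Thm. 8.1, §9–§10 of the source). Proof: by the
superharmonicity `𝒩*_s(x,t) ≤ ∫ 𝒩*_s(·,σ) dν_{x,t;σ}` ((5.15),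
`kernelNashEntropy_le_integral_kernelNashEntropy_heatKernelMeasure`) it suffices to bound
`𝒩*_s(y, σ)` for `σ − s` small, with the metric `g_s` FIXED. By the Gibbs variational
inequality (`neg_integral_mul_log_le_integral_mul_add_log`) with the potential
`d_s(z,·)²/(2σ_G²)`, `σ_G² = H_m(σ−s)/m`, at an `H_m`-centre `(z, s)` of `(y, σ)`
(`∫ d_s(z,·)² dν ≤ H_m(σ−s)`), `−∫ K log K dV_s ≤ m/2 + log ∫ e^{−d_s(z,·)²/(2σ_G²)} dV_s`, and the
last integral is at most `(1+ε)(2πσ_G²)^{m/2} + Vol_s(M) e^{−r₀²/(2σ_G²)}` by the sharp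
small-ball volume asymptotics of `g_s` (`exists_forall_riemVolume_ball_le_one_add_mul`) and the
radial comparison `integral_comp_edist_le_of_ball_le`; letting `σ → s` and then `ε → 0` gives the
claim. Everything is proved; no definitions, no named facts.

## References

* R. H. Bamler, *Entropy and heat kernel bounds on a Ricci flow background*, arXiv:2008.07093
  (2020), §5.1 Prop. 5.2, (5.15). [Bamler2020Entropy]
-/

noncomputable section

open Set Filter Function MeasureTheory Measure Module
open scoped Manifold ContDiff Topology ENNReal NNReal

namespace Literature.Geometry.Riemannian

open Lorentzian Lorentzian.PseudoRiemannianMetric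

/-! ### Two real lemmas -/

/-- `x^{m/2} e^{−c x} → 0` as `x → ∞`, in the form: for `c, δ > 0` there is `X > 0` with
`x^{m/2} e^{−c x} ≤ δ` for all `x ≥ X`. [folklore] -/
theorem exists_forall_ge_rpow_mul_exp_neg_mul_le (m : ℕ) {c δ : ℝ} (hc : 0 < c) (hδ : 0 < δ) :
    ∃ X : ℝ, 0 < X ∧ ∀ x : ℝ, X ≤ x → x ^ ((m : ℝ) / 2) * Real.exp (-c * x) ≤ δ := by
  have ht := tendsto_rpow_mul_exp_neg_mul_atTop_nhds_zero ((m : ℝ) / 2) c hc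
  have hev : ∀ᶠ x in atTop, x ^ ((m : ℝ) / 2) * Real.exp (-c * x) ≤ δ :=
    (ht.eventually (Iic_mem_nhds hδ)).mono fun x hx ↦ hx
  obtain ⟨X₀, hX₀⟩ := Filter.eventually_atTop.1 hev
  exact ⟨max X₀ 1, lt_of_lt_of_le one_pos (le_max_right _ _),
    fun x hx ↦ hX₀ x ((le_max_left _ _).trans hx)⟩

/-- The Gaussian integral on `ℝᵐ` in the form used here:
`∫ exp(−‖v‖²/(2σ²)) dv = (2πσ²)^{m/2}`, together with the integrability of the integrand.
[folklore] -/
theorem integral_exp_neg_sq_norm_div (m : ℕ) {σ2 : ℝ} (hσ : 0 < σ2) :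
    Integrable (fun v : EuclideanSpace ℝ (Fin m) ↦ Real.exp (-‖v‖ ^ 2 / (2 * σ2))) ∧
    ∫ v : EuclideanSpace ℝ (Fin m), Real.exp (-‖v‖ ^ 2 / (2 * σ2)) =
      (2 * Real.pi * σ2) ^ ((m : ℝ) / 2) := by
  have hb : 0 < 1 / (2 * σ2) := by positivity
  have key := GaussianFourier.integral_rexp_neg_mul_sq_norm (V := EuclideanSpace ℝ (Fin m)) hb
  have e : (fun v : EuclideanSpace ℝ (Fin m) ↦ Real.exp (-‖v‖ ^ 2 / (2 * σ2))) =
      fun v ↦ Real.exp (-(1 / (2 * σ2)) * ‖v‖ ^ 2) := by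
    funext v; congr 1; ring
  rw [e]
  have hval : (Real.pi / (1 / (2 * σ2))) ^ ((Module.finrank ℝ (EuclideanSpace ℝ (Fin m)) : ℝ) / 2)
      = (2 * Real.pi * σ2) ^ ((m : ℝ) / 2) := by
    rw [finrank_euclideanSpace_fin]; congr 1; field_simp
  refine ⟨?_, by rw [key, hval]⟩
  by_contra hni
  have h0 := integral_undef hni
  rw [key, hval] at h0
  exact absurd h0 (Real.rpow_pos_of_pos (by positivity) _).ne'

/-! ### The bound -/

section Kernel

variable {m : ℕ} {M : Type*} [TopologicalSpace M] [ChartedSpace (EuclideanSpace ℝ (Fin m)) M]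
  [IsManifold 𝓘(ℝ, EuclideanSpace ℝ (Fin m)) ∞ M] [T2Space M] [CompactSpace M]
  [SecondCountableTopology M] [MeasurableSpace M] [BorelSpace M] [ConnectedSpace M] [T3Space M]
  {h : ℝ → PseudoRiemannianMetric 𝓘(ℝ, EuclideanSpace ℝ (Fin m)) ∞ (EuclideanSpace ℝ (Fin m))
    (TangentSpace 𝓘(ℝ, EuclideanSpace ℝ (Fin m)) : M → Type _)}
  {cov : ℝ → CovariantDerivative 𝓘(ℝ, EuclideanSpace ℝ (Fin m)) (EuclideanSpace ℝ (Fin m))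
    (TangentSpace 𝓘(ℝ, EuclideanSpace ℝ (Fin m)) : M → Type _)}
  {a T : ℝ}

set_option maxHeartbeats 1600000 in
/-- **The pointed Nash entropy near the pole is almost bounded by the Gaussian value, with the
metric frozen**: for a Ricci flow on `[a, T]` of a smooth family of Riemannian metrics on a closed
connected manifold modelled on `ℝᵐ`, `m ≥ 1`, `a < s < T` and `ε > 0`, there is `τ₀ > 0` such that
`𝒩*_s(y, σ) ≤ (m/2) log(H_m/(2m)) + ε` for all `y` and all `σ ∈ (s, s + τ₀]`, `σ ≤ T`. Gibbs'
inequality with the potential `d_s(z,·)²/(2σ_G²)` at an `H_m`-centre, the Gaussian integral, and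
the sharp small-ball volume asymptotics of the fixed metric `g_s`.
[cite: Bamler2020Entropy, §5.1, Prop. 5.2] -/
theorem IsRicciFlow.exists_forall_kernelNashEntropy_le_near (hflow : IsRicciFlow h cov (Icc a T))
    (hh : IsContMDiffFamilyOn ∞ h univ) (hR : ∀ r, (h r).IsRiemannian) (hm : 0 < m) {s : ℝ}
    (has : a < s) (hsT : s < T) {ε : ℝ} (hε : 0 < ε) :
    ∃ τ₀ : ℝ, 0 < τ₀ ∧ ∀ ⦃σ : ℝ⦄, s < σ → σ ≤ s + τ₀ → σ ≤ T → ∀ y : M,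
      pointedNashEntropy h (fun r v ↦ hflow.heatKernelFn hh hR σ y (v, r)) m σ s ≤
        (m : ℝ) / 2 * Real.log ((((m : ℝ) - 1) * Real.pi ^ 2 / 2 + 4) / (2 * m)) + ε := by
  classical
  set Hm : ℝ := ((m : ℝ) - 1) * Real.pi ^ 2 / 2 + 4 with hHm
  have hmR : (0 : ℝ) < m := by exact_mod_cast hm
  have hHm0 : 0 < Hm := by
    have h1 : (1 : ℝ) ≤ m := by exact_mod_cast hm
    have : 0 ≤ ((m : ℝ) - 1) * Real.pi ^ 2 / 2 := by
      apply div_nonneg _ (by norm_num); exact mul_nonneg (by linarith) (sq_nonneg _)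
    rw [hHm]; linarith
  -- `ε₁` with `log (1 + 2 ε₁) ≤ ε`
  set ε₁ : ℝ := min (1 / 2) (ε / 2) with hε₁
  have hε₁0 : 0 < ε₁ := lt_min (by norm_num) (by positivity)
  have hε₁ε : ε₁ ≤ ε / 2 := min_le_right _ _
  have hlogε : Real.log (1 + 2 * ε₁) ≤ ε := by
    have := Real.log_le_sub_one_of_pos (by positivity : (0 : ℝ) < 1 + 2 * ε₁)
    linarith
  -- the fixed metric `g_s`: its volume and its sharp small-ball radius
  haveI : IsFiniteMeasure (h s).riemVolume := ⟨(h s).riemVolume_univ_lt_top⟩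
  set V : ℝ := (h s).riemVolume.real univ with hV
  have hV0 : 0 ≤ V := measureReal_nonneg
  obtain ⟨r₀, hr₀, hvol⟩ := exists_forall_riemVolume_ball_le_one_add_mul (h s) (hR s) hε₁0
  -- choose `τ₀` with `V e^{−r₀² m/(2 Hm τ)} ≤ ε₁ (2π Hm τ/m)^{m/2}` for `τ ≤ τ₀`, via `u = 1/τ`
  set c : ℝ := r₀ ^ 2 * m / (2 * Hm) with hc
  have hc0 : 0 < c := by positivity
  set CG : ℝ := (2 * Real.pi * Hm / m) ^ ((m : ℝ) / 2) with hCG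
  have hCG0 : 0 < CG := Real.rpow_pos_of_pos (by positivity) _
  set δ : ℝ := ε₁ * CG / (V + 1) with hδ
  have hδ0 : 0 < δ := by positivity
  obtain ⟨X, hX0, hX⟩ := exists_forall_ge_rpow_mul_exp_neg_mul_le m hc0 hδ0
  refine ⟨1 / X, by positivity, fun σ hsσ hσu hσT y ↦ ?_⟩
  /- ── the scale `τ = σ − s` and `xτ = 1/τ ≥ X` ── -/
  set τ : ℝ := σ - s with hτdef
  have hτ : 0 < τ := sub_pos.2 hsσ
  have hτu : τ ≤ 1 / X := by linarith
  have hxX : X ≤ 1 / τ := by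
    rw [le_div_iff₀ hτ]
    calc X * τ ≤ X * (1 / X) := mul_le_mul_of_nonneg_left hτu hX0.le
      _ = 1 := mul_one_div_cancel hX0.ne'
  have hσ : σ ∈ Ioc a T := ⟨has.trans hsσ, hσT⟩
  have hsI : s ∈ Ioo a σ := ⟨has, hsσ⟩
  set K : M → ℝ := fun w ↦ hflow.heatKernelFn hh hR σ y (w, s) with hK
  have hKc : Continuous K := hflow.continuous_heatKernelFn_slice hh hR hσ y hsI
  have hKpos : ∀ w, 0 < K w := fun w ↦ hflow.heatKernelFn_pos hh hR hσ y ⟨mem_univ _, hsI⟩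
  have hint : ∀ {f : M → ℝ}, Continuous f → Integrable f (h s).riemVolume := fun hf ↦
    hf.integrable_of_hasCompactSupport (HasCompactSupport.of_compactSpace _)
  have hmass : ∫ w, K w ∂(h s).riemVolume = 1 := hflow.integral_heatKernelFn_eq_one hh hR hσ y hsI
  -- the entropy, explicitly
  have hNeq := hflow.kernelNashEntropy_eq hh hR hσ y (r := s) hsI
  /- ── an `H_m`-centre and the potential ── -/
  obtain ⟨z, hz⟩ := hflow.exists_lintegral_edist_sq_heatKernelMeasure_le hh hR hm
    ⟨has.le, hsT.le⟩ ⟨hσ.1.le, hσT⟩ hsσ.le y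
  set σ2 : ℝ := Hm * τ / m with hσ2
  have hσ2pos : 0 < σ2 := by positivity
  set d : M → ℝ := fun w ↦ ((h s).edist (hR s) z w).toReal with hd
  have hdc : Continuous d :=
    ENNReal.continuousOn_toReal.comp_continuous
      (((h s).continuous_edist (hR s)).comp (.prodMk_right z))
      fun w ↦ PseudoRiemannianMetric.edist_ne_top (hR s) z w
  have hd0 : ∀ w, 0 ≤ d w := fun w ↦ ENNReal.toReal_nonneg
  set Vf : M → ℝ := fun w ↦ d w ^ 2 / (2 * σ2) with hVf
  have hVfc : Continuous Vf := (hdc.pow 2).div_const _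
  /- ── Gibbs ── -/
  have hGibbs := neg_integral_mul_log_le_integral_mul_add_log (h s).riemVolume (ρ := K) (V := Vf)
    (hint hKc) (fun w ↦ (hKpos w).le) hmass
    (hint (hKc.mul (Real.continuousOn_log.comp_continuous hKc fun w ↦ (hKpos w).ne')))
    hVfc.measurable (hint (hVfc.mul hKc)) (hint (Real.continuous_exp.comp hVfc.neg))
  /- ── the second moment: `∫ Vf K dV_s ≤ m/2` ── -/
  have hmom : ∫ w, Vf w * K w ∂(h s).riemVolume ≤ (m : ℝ) / 2 := by
    -- `∫ d² K dV_s = ∫ d² dν ≤ Hm τ`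
    have h1 : ∫ w, d w ^ 2 * K w ∂(h s).riemVolume =
        ∫ w, d w ^ 2 ∂(heatKernelMeasure hh hR σ y s) :=
      (hflow.integral_heatKernelMeasure_eq_integral_mul_heatKernelFn hh hR hσ y hsI _).symm
    have h2 : ∫ w, d w ^ 2 ∂(heatKernelMeasure hh hR σ y s) ≤ Hm * τ := by
      have hfin : ∀ w, (h s).edist (hR s) z w ≠ ⊤ := fun w ↦
        PseudoRiemannianMetric.edist_ne_top (hR s) z w
      have e : ∀ w, ENNReal.ofReal (d w ^ 2) = (h s).edist (hR s) z w ^ 2 := fun w ↦ by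
        rw [hd]; simp only
        rw [ENNReal.ofReal_pow ENNReal.toReal_nonneg, ENNReal.ofReal_toReal (hfin w)]
      have hlin : ∫⁻ w, ENNReal.ofReal (d w ^ 2) ∂(heatKernelMeasure hh hR σ y s) ≤
          ENNReal.ofReal (Hm * τ) := by
        calc ∫⁻ w, ENNReal.ofReal (d w ^ 2) ∂(heatKernelMeasure hh hR σ y s)
            = ∫⁻ w, (h s).edist (hR s) z w ^ 2 ∂(heatKernelMeasure hh hR σ y s) :=
              lintegral_congr fun w ↦ e w
          _ ≤ ENNReal.ofReal (Hm * τ) := by simpa [hHm, hτdef] using hz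
      have hnn : 0 ≤ᵐ[heatKernelMeasure hh hR σ y s] fun w ↦ d w ^ 2 :=
        Eventually.of_forall fun w ↦ sq_nonneg _
      have hmeas : AEStronglyMeasurable (fun w ↦ d w ^ 2) (heatKernelMeasure hh hR σ y s) :=
        (hdc.pow 2).aestronglyMeasurable
      rw [integral_eq_lintegral_of_nonneg_ae hnn hmeas]
      have hne : ∫⁻ w, ENNReal.ofReal (d w ^ 2) ∂(heatKernelMeasure hh hR σ y s) ≠ ⊤ :=
        (hlin.trans_lt ENNReal.ofReal_lt_top).ne
      have := ENNReal.toReal_mono ENNReal.ofReal_ne_top hlin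
      rwa [ENNReal.toReal_ofReal (by positivity)] at this
    have e3 : (fun w ↦ Vf w * K w) = fun w ↦ (1 / (2 * σ2)) * (d w ^ 2 * K w) := by
      funext w; rw [hVf]; simp only; ring
    rw [e3, integral_const_mul, h1]
    calc 1 / (2 * σ2) * ∫ w, d w ^ 2 ∂(heatKernelMeasure hh hR σ y s)
        ≤ 1 / (2 * σ2) * (Hm * τ) := mul_le_mul_of_nonneg_left h2 (by positivity)
      _ = (m : ℝ) / 2 := by rw [hσ2]; field_simp
  /- ── the partition function: `Z ≤ (1 + 2ε₁) (2πσ²)^{m/2}` ── -/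
  set F : ℝ → ℝ := fun r ↦ Real.exp (-(max r 0) ^ 2 / (2 * σ2)) with hF
  have hFanti : Antitone F := by
    intro r₁ r₂ hr
    rw [hF]; simp only
    apply Real.exp_le_exp.2
    rw [neg_div, neg_div, neg_le_neg_iff]
    apply div_le_div_of_nonneg_right _ (by positivity)
    exact pow_le_pow_left₀ (le_max_right _ _) (max_le_max hr le_rfl) 2
  have hF0 : ∀ r, 0 ≤ F r := fun r ↦ (Real.exp_pos _).le
  have hFc : Continuous F := by
    rw [hF]
    exact Real.continuous_exp.comp (((continuous_id.max continuous_const).pow 2).neg.div_const _)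
  have hFnorm : ∀ v : EuclideanSpace ℝ (Fin m), F ‖v‖ = Real.exp (-‖v‖ ^ 2 / (2 * σ2)) := by
    intro v; rw [hF]; simp only [max_eq_left (norm_nonneg v)]
  obtain ⟨hGi, hGval⟩ := integral_exp_neg_sq_norm_div m hσ2pos
  have hFi : Integrable (fun v : EuclideanSpace ℝ (Fin m) ↦ F ‖v‖) :=
    hGi.congr (Eventually.of_forall fun v ↦ (hFnorm v).symm)
  have hFd : ∀ w, F (d w) = Real.exp (-Vf w) := by
    intro w; rw [hF, hVf]; simp only [max_eq_left (hd0 w), neg_div]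
  have hZle := integral_comp_edist_le_of_ball_le (h s) (hR s) z hFanti hF0 hFc hFi hε₁0.le hr₀
    (fun r hr hrr₀ ↦ hvol z r hr hrr₀)
  have hZeq : ∫ w, Real.exp (-Vf w) ∂(h s).riemVolume = ∫ w, F (d w) ∂(h s).riemVolume :=
    integral_congr_ae (Eventually.of_forall fun w ↦ (hFd w).symm)
  have hGval' : ∫ v : EuclideanSpace ℝ (Fin m), F ‖v‖ = (2 * Real.pi * σ2) ^ ((m : ℝ) / 2) := by
    rw [integral_congr_ae (Eventually.of_forall fun v ↦ hFnorm v)]; exact hGval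
  -- the tail `V F(r₀) ≤ ε₁ (2πσ²)^{m/2}`
  have hP0 : 0 < (2 * Real.pi * σ2) ^ ((m : ℝ) / 2) := Real.rpow_pos_of_pos (by positivity) _
  have htail : V * F r₀ ≤ ε₁ * (2 * Real.pi * σ2) ^ ((m : ℝ) / 2) := by
    set xτ : ℝ := 1 / τ with hxτ
    have hxτ0 : 0 < xτ := by positivity
    have hFr₀ : F r₀ = Real.exp (-c * xτ) := by
      rw [hF]; simp only [max_eq_left hr₀.le]
      congr 1; rw [hc, hσ2, hxτ]; field_simp
    have hsplit : (2 * Real.pi * σ2) ^ ((m : ℝ) / 2) = CG * τ ^ ((m : ℝ) / 2) := by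
      rw [hCG, ← Real.mul_rpow (by positivity) hτ.le]; congr 1; rw [hσ2]; field_simp
    have hτx : τ ^ ((m : ℝ) / 2) * xτ ^ ((m : ℝ) / 2) = 1 := by
      rw [← Real.mul_rpow hτ.le hxτ0.le, hxτ, mul_one_div_cancel hτ.ne', Real.one_rpow]
    have hkey : V * (xτ ^ ((m : ℝ) / 2) * Real.exp (-c * xτ)) ≤ ε₁ * CG := by
      calc V * (xτ ^ ((m : ℝ) / 2) * Real.exp (-c * xτ)) ≤ V * δ :=
            mul_le_mul_of_nonneg_left (hX xτ hxX) hV0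
        _ = ε₁ * CG * (V / (V + 1)) := by rw [hδ]; field_simp
        _ ≤ ε₁ * CG * 1 := by
            refine mul_le_mul_of_nonneg_left ?_ (by positivity)
            rw [div_le_one (by positivity)]; linarith
        _ = ε₁ * CG := mul_one _
    rw [hFr₀, hsplit]
    have hτp : 0 < τ ^ ((m : ℝ) / 2) := Real.rpow_pos_of_pos hτ _
    calc V * Real.exp (-c * xτ)
        = V * (xτ ^ ((m : ℝ) / 2) * Real.exp (-c * xτ)) * τ ^ ((m : ℝ) / 2) := by
          rw [show V * (xτ ^ ((m : ℝ) / 2) * Real.exp (-c * xτ)) * τ ^ ((m : ℝ) / 2) =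
            V * Real.exp (-c * xτ) * (τ ^ ((m : ℝ) / 2) * xτ ^ ((m : ℝ) / 2)) by ring, hτx, mul_one]
      _ ≤ ε₁ * CG * τ ^ ((m : ℝ) / 2) := mul_le_mul_of_nonneg_right hkey hτp.le
      _ = ε₁ * (CG * τ ^ ((m : ℝ) / 2)) := by ring
  have hZ : ∫ w, Real.exp (-Vf w) ∂(h s).riemVolume ≤ (1 + 2 * ε₁) * (2 * Real.pi * σ2) ^ ((m : ℝ) / 2) := by
    rw [hZeq]
    have h1 : ((1 + ε₁) * ∫ v : EuclideanSpace ℝ (Fin m), F ‖v‖) =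
        (1 + ε₁) * (2 * Real.pi * σ2) ^ ((m : ℝ) / 2) := by rw [hGval']
    have h2 : (h s).riemVolume.real univ * F r₀ = V * F r₀ := by rw [hV]
    calc ∫ w, F (d w) ∂(h s).riemVolume
        ≤ ((1 + ε₁) * ∫ v : EuclideanSpace ℝ (Fin m), F ‖v‖) + (h s).riemVolume.real univ * F r₀ :=
          hZle
      _ = (1 + ε₁) * (2 * Real.pi * σ2) ^ ((m : ℝ) / 2) + V * F r₀ := by rw [h1, h2]
      _ ≤ (1 + ε₁) * (2 * Real.pi * σ2) ^ ((m : ℝ) / 2) + ε₁ * (2 * Real.pi * σ2) ^ ((m : ℝ) / 2) :=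
          by linarith [htail]
      _ = (1 + 2 * ε₁) * (2 * Real.pi * σ2) ^ ((m : ℝ) / 2) := by ring
  have hZpos : 0 < ∫ w, Real.exp (-Vf w) ∂(h s).riemVolume := by
    haveI : NeZero (h s).riemVolume :=
      ⟨(Measure.measure_univ_pos.1 (PseudoRiemannianMetric.riemVolume_univ_pos (hR s)))⟩
    exact integral_exp_pos (hint (Real.continuous_exp.comp hVfc.neg))
  /- ── assemble ── -/
  have hlogZ : Real.log (∫ w, Real.exp (-Vf w) ∂(h s).riemVolume) ≤
      Real.log (1 + 2 * ε₁) + (m : ℝ) / 2 * Real.log (2 * Real.pi * σ2) := by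
    calc Real.log (∫ w, Real.exp (-Vf w) ∂(h s).riemVolume)
        ≤ Real.log ((1 + 2 * ε₁) * (2 * Real.pi * σ2) ^ ((m : ℝ) / 2)) := Real.log_le_log hZpos hZ
      _ = Real.log (1 + 2 * ε₁) + (m : ℝ) / 2 * Real.log (2 * Real.pi * σ2) := by
          rw [Real.log_mul (by positivity) hP0.ne', Real.log_rpow (by positivity)]
  -- `−∫ K log K ≤ m/2 + log Z`
  have hS : ∫ w, -(K w * Real.log (K w)) ∂(h s).riemVolume ≤
      (m : ℝ) / 2 + Real.log (1 + 2 * ε₁) + (m : ℝ) / 2 * Real.log (2 * Real.pi * σ2) := by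
    rw [integral_neg]
    linarith [hGibbs, hmom, hlogZ]
  rw [hNeq]
  -- `(m/2) log(2πσ²) − (m/2) log(4πτ) = (m/2) log(Hm/(2m))`
  have hlogs : (m : ℝ) / 2 * Real.log (2 * Real.pi * σ2) - (m : ℝ) / 2 * Real.log (4 * Real.pi * τ)
      = (m : ℝ) / 2 * Real.log (Hm / (2 * m)) := by
    rw [← mul_sub, ← Real.log_div (by positivity) (by positivity)]
    congr 2; rw [hσ2]; field_simp; ring
  have : ∫ w, -(hflow.heatKernelFn hh hR σ y (w, s) * Real.log (hflow.heatKernelFn hh hR σ y (w, s)))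
      ∂(h s).riemVolume = ∫ w, -(K w * Real.log (K w)) ∂(h s).riemVolume := rfl
  rw [this]
  linarith [hS, hlogs.le, hlogs.ge, hlogε]

/-- `H_m = (m−1)π²/2 + 4 ≥ 2m`, so `(m/2) log(H_m/(2m)) ≥ 0`. [folklore] -/
theorem concentrationConst_div_nonneg_log {m : ℕ} (hm : 0 < m) :
    0 ≤ (m : ℝ) / 2 * Real.log ((((m : ℝ) - 1) * Real.pi ^ 2 / 2 + 4) / (2 * m)) := by
  have hmR : (0 : ℝ) < m := by exact_mod_cast hm
  have h1 : (1 : ℝ) ≤ m := by exact_mod_cast hm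
  have hπ : (8 : ℝ) ≤ Real.pi ^ 2 := by nlinarith [Real.pi_gt_three]
  refine mul_nonneg (by positivity) (Real.log_nonneg ?_)
  rw [le_div_iff₀ (by positivity)]
  nlinarith

/-- **A universal upper bound of the pointed Nash entropy of the conjugate heat kernel**
(a weak form of Bamler 2020a, Prop. 5.2 `𝒩 ≤ 0`, proved without heat kernel asymptotics): for a
Ricci flow on `[a, T]` of a smooth family of Riemannian metrics on a closed connected manifold
modelled on `ℝᵐ`, `m ≥ 1`, and `a < s < t < T`,
`𝒩*_s(x, t) ≤ (m/2) log(H_m/(2m))`, `H_m = (m−1)π²/2 + 4`. Proof: superharmonicity (5.15)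
`𝒩*_s(x,t) ≤ ∫ 𝒩*_s(·,σ) dν_{x,t;σ}` with `σ ↓ s` and
`IsRicciFlow.exists_forall_kernelNashEntropy_le_near`. [cite: Bamler2020Entropy, §5.1, Prop. 5.2, (5.15)] -/
theorem kernelNashEntropy_le_universal (hflow : IsRicciFlow h cov (Icc a T))
    (hh : IsContMDiffFamilyOn ∞ h univ) (hR : ∀ r, (h r).IsRiemannian) (hm : 0 < m) {s t : ℝ}
    (has : a < s) (hst : s < t) (htT : t < T) (x : M) :
    pointedNashEntropy h (fun r v ↦ hflow.heatKernelFn hh hR t x (v, r)) m t s ≤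
      (m : ℝ) / 2 * Real.log ((((m : ℝ) - 1) * Real.pi ^ 2 / 2 + 4) / (2 * m)) := by
  set cm : ℝ := (m : ℝ) / 2 * Real.log ((((m : ℝ) - 1) * Real.pi ^ 2 / 2 + 4) / (2 * m)) with hcm
  have hcm0 : 0 ≤ cm := concentrationConst_div_nonneg_log hm
  refine le_of_forall_pos_le_add fun ε hε ↦ ?_
  obtain ⟨τ₀, hτ₀, hnear⟩ :=
    hflow.exists_forall_kernelNashEntropy_le_near hh hR hm has (hst.trans htT) hε
  set σ : ℝ := s + min τ₀ ((t - s) / 2) with hσ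
  have hmin0 : 0 < min τ₀ ((t - s) / 2) := lt_min hτ₀ (by linarith)
  have hsσ : s < σ := by rw [hσ]; linarith
  have hσt : σ < t := by
    have := min_le_right τ₀ ((t - s) / 2); rw [hσ]; linarith
  have hσu : σ ≤ s + τ₀ := by
    have := min_le_left τ₀ ((t - s) / 2); rw [hσ]; linarith
  have hsuper := kernelNashEntropy_le_integral_kernelNashEntropy_heatKernelMeasure hflow hh hR
    has hsσ hσt htT x
  refine hsuper.trans ?_
  have hbound : ∀ z : M,
      pointedNashEntropy h (fun r v ↦ hflow.heatKernelFn hh hR σ z (v, r)) m σ s ≤ cm + ε :=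
    fun z ↦ hnear hsσ hσu (hσt.le.trans htT.le) z
  set ν : Measure M := heatKernelMeasure hh hR t x σ with hν
  haveI : IsProbabilityMeasure ν := by rw [hν]; infer_instance
  by_cases hint : Integrable
      (fun z ↦ pointedNashEntropy h (fun r v ↦ hflow.heatKernelFn hh hR σ z (v, r)) m σ s) ν
  · calc ∫ z, pointedNashEntropy h (fun r v ↦ hflow.heatKernelFn hh hR σ z (v, r)) m σ s ∂ν
        ≤ ∫ _z, (cm + ε) ∂ν := integral_mono hint (integrable_const _) hbound
      _ = cm + ε := by simp
  · rw [integral_undef hint]; linarith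

end Kernel

end Literature.Geometry.Riemannian

end
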